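import Mathlib
import Summits.Ventures.HodgeRepro2.WeilIntegral

/-!
# A2 annex — the model integral `∫_B` lives in the top degree

In p5's twelve-plane model (`WeilPlanes` / `WeilIntegral`: `A ι = ⋀^* V ι` with `V ι = (Gen ι → ℂ)`,
`Gen ι = ι × Bool`, `gen j = ι(e_j)` the basis vectors, `mono l` the wedge monomials, `integral` the
model of `∫_B`), the integral of a monomial vanishes unless the monomial is the volume form
(p5's `integral_mono_eq_zero`).  This file records the degree form of that fact, used to transcribe
«`f_*c_j ∈ H^{22}(B)` pairs only with `H^2(B)`» (Corollary A8.2, route/T4-A2-p6.md v6 l. 118, and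
the pairing computations of A5) as a statement about the exterior-power grading:

* `exteriorPower_le_span_mono`: `⋀^d V ι` is spanned by the monomials of length `d`
  (Mathlib's `exteriorPower.ιMulti_span_fixedDegree_of_span_eq_top` on the standard basis);
* `integral_mono_eq_zero_of_length_ne`: `∫_B mono l = 0` unless `l.length = |Gen ι| = 2|ι|`;
* **`integral_mul_mono_eq_zero_of_mem`** / **`integral_mul_eq_zero_of_mem_of_mem`**: for
  `z ∈ ⋀^d`, `∫_B z ∧ mono l = 0` when `d + l.length ≠ 2|ι|`, and `∫_B z ∧ y = 0` for
  `y ∈ ⋀^e` when `d + e ≠ 2|ι|` — i.e. `∫_B` is supported in degree `2|ι| = dim_ℝ B = 24`.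

With it, the hypothesis «`∫_B z₂ ∧ (monomial of length ≠ 2) = 0`» of `A2TripleSumPairing.
pairThree_integral_eq_zero` follows from `z₂ ∈ ⋀^{2|ι| − 2}` (`deg f_*c₂ = 22` for `|ι| = 12`):
`integral_mul_mono_eq_zero_of_degree_two_complement`.

Seat p6 (A2 owner), gen 16.  §8 (d): uses an L-value-free non-vanishing device: NO.
-/

namespace Summit.Ventures.HodgeRepro2.A2IntegralDegree

open WeilPlanes WeilIntegral

variable {ι : Type*} [DecidableEq ι] [Fintype ι]

/-- The standard basis vectors span `V ι = (Gen ι → ℂ)`. -/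
theorem span_single_eq_top :
    Submodule.span ℂ (Set.range fun j : Gen ι => (Pi.single j (1 : ℂ) : V ι)) = ⊤ := by
  have h := (Pi.basisFun ℂ (Gen ι)).span_eq
  have hfun : (⇑(Pi.basisFun ℂ (Gen ι)) : Gen ι → V ι) = fun j => Pi.single j (1 : ℂ) :=
    funext fun j => Pi.basisFun_apply ℂ (Gen ι) j
  rwa [hfun] at h

omit [Fintype ι] in
/-- A wedge of `d` basis vectors is the monomial of the corresponding index list. -/
theorem ιMulti_single_eq_mono (d : ℕ) (k : Fin d → Gen ι) :
    ExteriorAlgebra.ιMulti ℂ d (fun i => (Pi.single (k i) (1 : ℂ) : V ι)) = mono (List.ofFn k) := by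
  rw [ExteriorAlgebra.ιMulti_apply, mono, List.map_ofFn]
  rfl

/-- `⋀^d V ι` is spanned by the wedge monomials of length `d`. -/
theorem exteriorPower_le_span_mono (d : ℕ) :
    (⋀[ℂ]^d (V ι) : Submodule ℂ (A ι)) ≤
      Submodule.span ℂ {x | ∃ l : List (Gen ι), l.length = d ∧ x = mono l} := by
  rw [← exteriorPower.ιMulti_span_fixedDegree_of_span_eq_top ℂ d (V ι) span_single_eq_top,
    Submodule.span_le]
  rintro _ ⟨a, ha, rfl⟩
  have hsel : ∀ i : Fin d, ∃ j : Gen ι, (Pi.single j (1 : ℂ) : V ι) = a i := fun i =>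
    ha (Set.mem_range_self i)
  choose k hk using hsel
  have ha' : a = fun i => (Pi.single (k i) (1 : ℂ) : V ι) := by
    funext i
    exact (hk i).symm
  rw [ha', ιMulti_single_eq_mono]
  exact Submodule.subset_span ⟨List.ofFn k, List.length_ofFn, rfl⟩

/-- A monomial whose length is not `|Gen ι|` is not the volume form: its integral vanishes. -/
theorem integral_mono_eq_zero_of_length_ne {l : List (Gen ι)}
    (hl : l.length ≠ Fintype.card (Gen ι)) : integral (mono l) = 0 := by
  apply integral_mono_eq_zero
  by_cases hnd : l.Nodup
  · right
    by_contra hall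
    simp only [not_exists, not_not] at hall
    apply hl
    have huniv : l.toFinset = Finset.univ := Finset.eq_univ_iff_forall.mpr fun j =>
      List.mem_toFinset.mpr (hall j)
    rw [← List.toFinset_card_of_nodup hnd, huniv, Finset.card_univ]
  · exact Or.inl hnd

/-- For `z ∈ ⋀^d` and a monomial of length `m` with `d + m ≠ |Gen ι|`, `∫_B z ∧ mono l = 0`. -/
theorem integral_mul_mono_eq_zero_of_mem {d : ℕ} {z : A ι}
    (hz : z ∈ (⋀[ℂ]^d (V ι) : Submodule ℂ (A ι))) (l : List (Gen ι))
    (hl : d + l.length ≠ Fintype.card (Gen ι)) : integral (z * mono l) = 0 := by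
  refine Submodule.span_induction (p := fun z _ => integral (z * mono l) = 0) ?_ ?_ ?_ ?_
    (exteriorPower_le_span_mono d hz)
  · rintro _ ⟨l', hl', rfl⟩
    rw [← mono_append]
    apply integral_mono_eq_zero_of_length_ne
    rwa [List.length_append, hl']
  · simp
  · intro x y _ _ hx hy
    rw [add_mul, map_add, hx, hy, add_zero]
  · intro a x _ hx
    rw [smul_mul_assoc, map_smul, hx, smul_zero]

/-- For `z ∈ ⋀^d` and `y ∈ ⋀^e` with `d + e ≠ |Gen ι|`, `∫_B z ∧ y = 0`: the model integral is
supported in the top degree `|Gen ι| = 2|ι|`. -/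
theorem integral_mul_eq_zero_of_mem_of_mem {d e : ℕ} {z y : A ι}
    (hz : z ∈ (⋀[ℂ]^d (V ι) : Submodule ℂ (A ι))) (hy : y ∈ (⋀[ℂ]^e (V ι) : Submodule ℂ (A ι)))
    (hde : d + e ≠ Fintype.card (Gen ι)) : integral (z * y) = 0 := by
  refine Submodule.span_induction (p := fun y _ => integral (z * y) = 0) ?_ ?_ ?_ ?_
    (exteriorPower_le_span_mono e hy)
  · rintro _ ⟨l, hl, rfl⟩
    exact integral_mul_mono_eq_zero_of_mem hz l (by rwa [hl])
  · simp
  · intro x y _ _ hx hy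
    rw [mul_add, map_add, hx, hy, add_zero]
  · intro a x _ hx
    rw [mul_smul_comm, map_smul, hx, smul_zero]

omit [DecidableEq ι] in
/-- The cardinality of the generator set: `|Gen ι| = 2|ι|` (`Gen ι = ι × Bool`). -/
theorem card_gen : Fintype.card (Gen ι) = 2 * Fintype.card ι := by
  simp [Gen, Fintype.card_prod, Fintype.card_bool, mul_comm]

/-- The transcription of «`deg f_*c₂ = 22 = 2|ι| − 2` pairs only with degree `2`»: for
`z ∈ ⋀^{2|ι| − 2}` (with `|ι| ≥ 1`) and every monomial of length `≠ 2`, `∫_B z ∧ mono l = 0` —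
the hypothesis `hdeg` of `A2TripleSumPairing.pairThree_integral_eq_zero`. -/
theorem integral_mul_mono_eq_zero_of_degree_two_complement (hι : 1 ≤ Fintype.card ι)
    {z : A ι} (hz : z ∈ (⋀[ℂ]^(2 * Fintype.card ι - 2) (V ι) : Submodule ℂ (A ι)))
    (l : List (Gen ι)) (hl : l.length ≠ 2) : integral (z * mono l) = 0 := by
  apply integral_mul_mono_eq_zero_of_mem hz l
  rw [card_gen]
  omega

end Summit.Ventures.HodgeRepro2.A2IntegralDegree
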